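import Mathlib
import Literature.AlgebraicGeometry.Resolution.AffineBlowupRegular
import Literature.AlgebraicGeometry.Resolution.AffineBlowupIntegral
import Literature.AlgebraicGeometry.Resolution.MvPolynomialKillVars

/-!
# Rung LSB «linear small blocks»: order, augmentation ideals, centre, and the blow-up of a coordinate subspace

(crux stmt-ResolutionOfSingularities-15640 `WildQuotients.WildQuotientResolution`, line `Sketch`;
rung LSB of `L/w45c/CHAIN.md` v3 / `W45cPlanSignaturesV3.lean` (planner res-L1-w45c-plan-1);
[OURS · L1 W4.5c] — NOT a statement of any manuscript.)

A **coordinate `ℤ/p`-action with Jordan blocks of size `≤ 2`** on `𝔸ⁿ_k = Spec k[x₀,…,x_{n-1}]`: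
`σ xᵢ = xᵢ + x_{f i}` for `i ∈ D`, `σ xᵢ = xᵢ` for `i ∉ D`, with `f(D) ∩ D = ∅` (so the targets
`x_{f i}` are fixed). Over a field of characteristic `p` (ANY prime `p`, ANY `n`):
* `pow_apply_X_of_mem` / `pow_apply_X_of_not_mem` — `σᵐ xᵢ = xᵢ + m x_{f i}` on `D`, `σᵐ xᵢ = xᵢ` off `D`;
* `pow_prime_eq_one`, `ne_one_of_nonempty`, `card_zpowers`, `eq_one_of_empty` — LSB ORDER:
  `σ ^ p = 1`; `D ≠ ∅ → σ ≠ 1 ∧ |⟨σ⟩| = p`; `D = ∅ → σ = 1`;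
* `X_mem_augIdeal_of_transvection` — hfree′ (V3 (3)): for `σ xᵢ = xᵢ`, `σ x_j = x_j + xᵢ`,
  `σ ^ p = 1` and `1 ≠ g ∈ ⟨σ⟩`: `xᵢ ∈ ⟨g • b - b⟩` (`g = σᵐ`, `p ∤ m`, `g • x_j - x_j = m xᵢ`);
* `smul_X_of_not_mem`, `smul_sub_mem_centre`, `smul_centre_eq` — the centre
  `I = (x_{f i} : i ∈ D)` is fixed generatorwise, `g • r - r ∈ I` for every `g ∈ ⟨σ⟩` and `r`
  (`σ^{±1} ≡ id mod I`), and `g • I = I`;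
* `coordSubspace_blowup_regular` — S3′: for a non-empty set `S` of coordinates, the blow-up of `𝔸ⁿ`
  in `V(xᵢ : i ∈ S)` is regular, integral, proper and birational (`MvPolynomial.isWeaklyRegular_map_X`,
  `MvPolynomial.quotientSpanXEquiv`, `affineBlowup.isRegular_of_isWeaklyRegular`, `.isIntegral`,
  `.isProper`, `.isBirational`).
The instance `n = 4, D = {1,3}, f = (0,0,2,2)` is programme T (`…TwoBlocks*`), and
`D = {1} × Fin m` is `𝔸^{2m}/(J₂^{⊕m})` (`…NBlocks*`).
-/

-- single-problem summit: the doubled namespace component `ResolutionOfSingularities` is forced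
set_option linter.dupNamespace false

noncomputable section

open MvPolynomial AlgebraicGeometry CategoryTheory Literature.AlgebraicGeometry.Resolution
open scoped Pointwise

namespace Summit.ResolutionOfSingularities.ResolutionOfSingularities.Theorems.WildQuotientResolution.LinearSmallBlocks

variable (k : Type) [Field k] (n : ℕ) (σ : MvPolynomial (Fin n) k ≃ₐ[k] MvPolynomial (Fin n) k)
  (D : Finset (Fin n)) (f : Fin n → Fin n) (hfD : ∀ i ∈ D, f i ∉ D)
  (hσD : ∀ i ∈ D, σ (X i) = X i + X (f i)) (hσ : ∀ i ∉ D, σ (X i) = X i)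

/-! ## Iterates and order -/

include hfD hσD hσ in
/-- `σᵐ xᵢ = xᵢ + m x_{f i}` for `i ∈ D`. [folklore] -/
theorem pow_apply_X_of_mem (m : ℕ) (i : Fin n) (hi : i ∈ D) :
    (σ ^ m) (X i) = X i + (m : MvPolynomial (Fin n) k) * X (f i) := by
  induction m with
  | zero => simp
  | succ m ih =>
    rw [pow_succ', AlgEquiv.mul_apply, ih, map_add, map_mul, map_natCast, hσD i hi,
      hσ (f i) (hfD i hi)]
    push_cast
    ring

include hσ in
/-- `σᵐ xᵢ = xᵢ` for `i ∉ D`. [folklore] -/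
theorem pow_apply_X_of_not_mem (m : ℕ) (i : Fin n) (hi : i ∉ D) : (σ ^ m) (X i) = X i := by
  induction m with
  | zero => simp
  | succ m ih => rw [pow_succ', AlgEquiv.mul_apply, ih, hσ i hi]

include hfD hσD hσ in
/-- **`σ ^ p = 1`** in characteristic `p` (every `σᵖ xᵢ = xᵢ` since `p = 0` in `k`). [folklore] -/
theorem pow_prime_eq_one (p : ℕ) [CharP k p] : σ ^ p = 1 := by
  classical
  have hp0 : (p : MvPolynomial (Fin n) k) = 0 := CharP.cast_eq_zero _ p
  have key : ((σ ^ p : MvPolynomial (Fin n) k ≃ₐ[k] MvPolynomial (Fin n) k) :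
      MvPolynomial (Fin n) k →ₐ[k] MvPolynomial (Fin n) k) = AlgHom.id k _ := by
    refine MvPolynomial.algHom_ext fun i => ?_
    change (σ ^ p) (X i) = X i
    by_cases hi : i ∈ D
    · rw [pow_apply_X_of_mem k n σ D f hfD hσD hσ p i hi, hp0, zero_mul, add_zero]
    · exact pow_apply_X_of_not_mem k n σ D hσ p i hi
  apply AlgEquiv.ext
  intro a
  have := DFunLike.congr_fun key a
  simpa using this

include hσD in
/-- **`σ ≠ 1` when `D` is non-empty** (`σ xᵢ = xᵢ + x_{f i} ≠ xᵢ`). [folklore] -/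
theorem ne_one_of_nonempty (hD : D.Nonempty) : σ ≠ 1 := by
  obtain ⟨i, hi⟩ := hD
  intro h
  have h1 := hσD i hi
  rw [h, AlgEquiv.one_apply] at h1
  have hX : (X (f i) : MvPolynomial (Fin n) k) = 0 := by
    have := congrArg (fun g => g - X i) h1
    simp only [sub_self, add_sub_cancel_left] at this
    exact this.symm
  exact MvPolynomial.X_ne_zero _ hX

include hfD hσD hσ in
/-- **`|⟨σ⟩| = p`** in characteristic `p` when `D` is non-empty. [folklore] -/
theorem card_zpowers (p : ℕ) (hp : p.Prime) [CharP k p] (hD : D.Nonempty) :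
    Nat.card (Subgroup.zpowers σ) = p := by
  haveI : Fact p.Prime := ⟨hp⟩
  rw [Nat.card_zpowers, orderOf_eq_prime (pow_prime_eq_one k n σ D f hfD hσD hσ p)
    (ne_one_of_nonempty k n σ D f hσD hD)]

include hσ in
/-- **`σ = 1` when `D = ∅`.** [folklore] -/
theorem eq_one_of_empty (hD : D = ∅) : σ = 1 := by
  have key : ((σ : MvPolynomial (Fin n) k ≃ₐ[k] MvPolynomial (Fin n) k) :
      MvPolynomial (Fin n) k →ₐ[k] MvPolynomial (Fin n) k) = AlgHom.id k _ := by
    refine MvPolynomial.algHom_ext fun i => ?_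
    change σ (X i) = X i
    exact hσ i (by rw [hD]; exact Finset.notMem_empty i)
  apply AlgEquiv.ext
  intro a
  have := DFunLike.congr_fun key a
  simpa using this

/-! ## hfree′: a transvection pair puts the fixed coordinate in every augmentation ideal -/

/-- **hfree for a transvection pair** (V3 (3); generalises `JordanBlock.X_zero_mem_augIdeal` and
`TwoBlocks.X_zero_mem_augIdeal`): if `σ xᵢ = xᵢ`, `σ x_j = x_j + xᵢ` and `σ ^ p = 1`, then for every
`1 ≠ g ∈ ⟨σ⟩`: `g = σᵐ` with `p ∤ m`, `g • x_j - x_j = m xᵢ` with `m ∈ kˣ`, so `xᵢ ∈ ⟨g • b - b⟩`.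
[folklore] -/
theorem X_mem_augIdeal_of_transvection (p : ℕ) (hp : p.Prime) [CharP k p] {n : ℕ}
    (σ : MvPolynomial (Fin n) k ≃ₐ[k] MvPolynomial (Fin n) k) (i j : Fin n)
    (hi : σ (X i) = X i) (hj : σ (X j) = X j + X i) (hσp : σ ^ p = 1)
    (g : Subgroup.zpowers σ) (hg : g ≠ 1) :
    (X i : MvPolynomial (Fin n) k) ∈
      Ideal.span (Set.range fun b : MvPolynomial (Fin n) k => g • b - b) := by
  classical
  -- iterates on `x_j`
  have hpow : ∀ m : ℕ, (σ ^ m) (X j) = X j + (m : MvPolynomial (Fin n) k) * X i := by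
    intro m
    induction m with
    | zero => simp
    | succ m ih =>
      rw [pow_succ', AlgEquiv.mul_apply, ih, map_add, map_mul, map_natCast, hj, hi]
      push_cast
      ring
  have hfin : IsOfFinOrder σ := isOfFinOrder_iff_pow_eq_one.mpr ⟨p, hp.pos, hσp⟩
  obtain ⟨m, hm⟩ : (g : MvPolynomial (Fin n) k ≃ₐ[k] MvPolynomial (Fin n) k) ∈ Submonoid.powers σ :=
    hfin.mem_powers_iff_mem_zpowers.mpr g.2
  have hm' : σ ^ m = (g : MvPolynomial (Fin n) k ≃ₐ[k] MvPolynomial (Fin n) k) := hm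
  have hndvd : ¬ p ∣ m := by
    rintro ⟨l, rfl⟩
    apply hg
    apply Subtype.ext
    change (g : MvPolynomial (Fin n) k ≃ₐ[k] MvPolynomial (Fin n) k) = 1
    rw [← hm', pow_mul, hσp, one_pow]
  have hmk : (m : k) ≠ 0 := fun h => hndvd ((CharP.cast_eq_zero_iff k p m).mp h)
  have hsmul : g • (X j : MvPolynomial (Fin n) k) - X j = (m : MvPolynomial (Fin n) k) * X i := by
    change (g : MvPolynomial (Fin n) k ≃ₐ[k] MvPolynomial (Fin n) k) (X j) - X j = _
    rw [← hm', hpow m]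
    ring
  have hx : (X i : MvPolynomial (Fin n) k) =
      C ((m : k)⁻¹) * (g • (X j : MvPolynomial (Fin n) k) - X j) := by
    rw [hsmul, ← mul_assoc, ← map_natCast (C : k →+* MvPolynomial (Fin n) k) m, ← map_mul,
      inv_mul_cancel₀ hmk, map_one, one_mul]
  rw [hx]
  exact Ideal.mul_mem_left _ _ (Ideal.subset_span ⟨X j, rfl⟩)

/-! ## The centre `(x_{f i} : i ∈ D)` -/

include hσ in
/-- **Coordinates off `D` are fixed by `⟨σ⟩`** (in particular the centre generators `x_{f i}`).
[folklore] -/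
theorem smul_X_of_not_mem (g : Subgroup.zpowers σ) (j : Fin n) (hj : j ∉ D) :
    g • (X j : MvPolynomial (Fin n) k) = X j := by
  obtain ⟨z, hz⟩ := Subgroup.mem_zpowers_iff.mp g.2
  change (g : MvPolynomial (Fin n) k ≃ₐ[k] MvPolynomial (Fin n) k) (X j) = _
  rw [← hz]
  have hfix : σ • (X j : MvPolynomial (Fin n) k) = X j := hσ j hj
  exact MulAction.fixedBy_subset_fixedBy_zpow (MvPolynomial (Fin n) k) σ z hfix

include hσD hσ in
/-- **`g • r ≡ r` modulo the centre `I = (x_{f i} : i ∈ D)`** for every `g ∈ ⟨σ⟩`: on the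
generators `σ xᵢ - xᵢ ∈ {0, x_{f i}} ⊆ I`, multiplicativity, then `σ⁻¹` and integer powers. [folklore] -/
theorem smul_sub_mem_centre (g : Subgroup.zpowers σ) (r : MvPolynomial (Fin n) k) :
    g • r - r ∈ Ideal.span (X '' (f '' (↑D : Set (Fin n))) : Set (MvPolynomial (Fin n) k)) := by
  classical
  set I : Ideal (MvPolynomial (Fin n) k) := Ideal.span (X '' (f '' (↑D : Set (Fin n)))) with hI
  obtain ⟨z, hz⟩ := Subgroup.mem_zpowers_iff.mp g.2
  have hσX : ∀ i : Fin n, σ (X i) - X i ∈ I := by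
    intro i
    by_cases hi : i ∈ D
    · rw [hσD i hi, add_sub_cancel_left]
      exact Ideal.subset_span ⟨f i, ⟨i, hi, rfl⟩, rfl⟩
    · rw [hσ i hi, sub_self]; exact Ideal.zero_mem _
  have hσf : ∀ r : MvPolynomial (Fin n) k, σ r - r ∈ I := by
    intro r
    induction r using MvPolynomial.induction_on with
    | C c =>
      have hc : σ (C c) = C c := σ.commutes c
      rw [hc, sub_self]; exact Ideal.zero_mem _
    | add r r' hr hr' =>
      have : σ (r + r') - (r + r') = (σ r - r) + (σ r' - r') := by rw [map_add]; ring
      rw [this]; exact Ideal.add_mem _ hr hr'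
    | mul_X r i hr =>
      have : σ (r * X i) - r * X i = (σ r - r) * σ (X i) + r * (σ (X i) - X i) := by
        rw [map_mul]; ring
      rw [this]
      exact Ideal.add_mem _ (Ideal.mul_mem_right _ _ hr) (Ideal.mul_mem_left _ _ (hσX i))
  have hσinvf : ∀ r : MvPolynomial (Fin n) k, σ⁻¹ r - r ∈ I := by
    intro r
    have h := hσf (σ⁻¹ r)
    have e : σ (σ⁻¹ r) = r := by rw [← AlgEquiv.mul_apply, mul_inv_cancel, AlgEquiv.one_apply]
    rw [e] at h
    have : σ⁻¹ r - r = -(r - σ⁻¹ r) := by ring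
    rw [this]
    exact neg_mem h
  have hzpow : ∀ (z : ℤ) (r : MvPolynomial (Fin n) k), (σ ^ z) r - r ∈ I := by
    intro z
    induction z using Int.induction_on with
    | zero => intro r; rw [zpow_zero, AlgEquiv.one_apply, sub_self]; exact Ideal.zero_mem _
    | succ m ih =>
      intro r
      rw [zpow_add_one, AlgEquiv.mul_apply]
      have e : (σ ^ (m : ℤ)) (σ r) - r = ((σ ^ (m : ℤ)) (σ r) - σ r) + (σ r - r) := by ring
      rw [e]
      exact Ideal.add_mem _ (ih (σ r)) (hσf r)
    | pred m ih =>
      intro r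
      rw [zpow_sub_one, AlgEquiv.mul_apply]
      have e : (σ ^ (-(m : ℤ))) (σ⁻¹ r) - r =
          ((σ ^ (-(m : ℤ))) (σ⁻¹ r) - σ⁻¹ r) + (σ⁻¹ r - r) := by ring
      rw [e]
      exact Ideal.add_mem _ (ih (σ⁻¹ r)) (hσinvf r)
  change (g : MvPolynomial (Fin n) k ≃ₐ[k] MvPolynomial (Fin n) k) r - r ∈ I
  rw [← hz]
  exact hzpow z r

include hfD hσ in
/-- **The centre `I = (x_{f i} : i ∈ D)` is `⟨σ⟩`-stable**: `g • I = I` (its generators are fixed).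
[folklore] -/
theorem smul_centre_eq (g : Subgroup.zpowers σ) :
    g • Ideal.span (X '' (f '' (↑D : Set (Fin n))) : Set (MvPolynomial (Fin n) k)) =
      Ideal.span (X '' (f '' (↑D : Set (Fin n)))) := by
  -- first for `σ` itself: the generators are fixed
  have hσ1 : Ideal.map (σ : MvPolynomial (Fin n) k →+* MvPolynomial (Fin n) k)
      (Ideal.span (X '' (f '' (↑D : Set (Fin n))))) = Ideal.span (X '' (f '' (↑D : Set (Fin n)))) := by
    rw [Ideal.map_span]
    congr 1
    ext r
    constructor
    · rintro ⟨_, ⟨_, ⟨i, hi, rfl⟩, rfl⟩, rfl⟩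
      refine ⟨f i, ⟨i, hi, rfl⟩, ?_⟩
      exact (hσ (f i) (hfD i hi)).symm
    · rintro ⟨_, ⟨i, hi, rfl⟩, rfl⟩
      refine ⟨X (f i), ⟨f i, ⟨i, hi, rfl⟩, rfl⟩, ?_⟩
      exact hσ (f i) (hfD i hi)
  have hσ' : σ • Ideal.span (X '' (f '' (↑D : Set (Fin n))) : Set (MvPolynomial (Fin n) k)) =
      Ideal.span (X '' (f '' (↑D : Set (Fin n)))) := hσ1
  obtain ⟨z, hz⟩ := Subgroup.mem_zpowers_iff.mp g.2
  change (g : MvPolynomial (Fin n) k ≃ₐ[k] MvPolynomial (Fin n) k) •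
      Ideal.span (X '' (f '' (↑D : Set (Fin n))) : Set (MvPolynomial (Fin n) k)) = _
  rw [← hz]
  exact MulAction.fixedBy_subset_fixedBy_zpow (Ideal (MvPolynomial (Fin n) k)) σ z hσ'

/-! ## S3′: the blow-up of `𝔸ⁿ` in a coordinate subspace -/

/-- `k[x]/(xᵢ : i ∈ S)` is a regular ring (the polynomial ring in the remaining variables,
`MvPolynomial.quotientSpanXEquiv`). [folklore] -/
theorem isRegularRing_quotient_span_X_image (S : Set (Fin n)) :
    IsRegularRing (MvPolynomial (Fin n) k ⧸ Ideal.span (X '' S : Set (MvPolynomial (Fin n) k))) :=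
  IsRegularRing.of_ringEquiv
    (Literature.AlgebraicGeometry.Resolution.MvPolynomial.quotientSpanXEquiv (R := k) S).toRingEquiv.symm

/-- **S3′: the blow-up of `𝔸ⁿ_k` in a coordinate subspace `V(xᵢ : i ∈ S)`, `S ≠ ∅`, is a regular
integral scheme, proper and birational over `𝔸ⁿ`** (`affineBlowup.isRegular_of_isWeaklyRegular`:
the `xᵢ`, `i ∈ S`, form a regular sequence — `MvPolynomial.isWeaklyRegular_map_X` on `S.toList` —
with regular quotient; `affineBlowup.isIntegral`, `.isProper`, `.isBirational`).
[cite: Liu2002, Thm. 8.1.19 (a)] [cite: StacksProject, Tag 02OS] -/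
theorem coordSubspace_blowup_regular (S : Finset (Fin n)) (hS : S.Nonempty) :
    Scheme.IsRegular (affineBlowup (Ideal.span (X '' (↑S : Set (Fin n))) :
      Ideal (MvPolynomial (Fin n) k))) ∧
    IsIntegral (affineBlowup (Ideal.span (X '' (↑S : Set (Fin n))) :
      Ideal (MvPolynomial (Fin n) k))) ∧
    IsProper (affineBlowup.π (Ideal.span (X '' (↑S : Set (Fin n))) :
      Ideal (MvPolynomial (Fin n) k))) ∧
    IsBirational (affineBlowup.π (Ideal.span (X '' (↑S : Set (Fin n))) :
      Ideal (MvPolynomial (Fin n) k))) := by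
  classical
  -- the centre as the span of the range of a `Fin`-indexed family: the list of its variables
  let x : Fin S.toList.length → MvPolynomial (Fin n) k := fun i => X (S.toList.get i)
  have hrange : Set.range x = X '' (↑S : Set (Fin n)) := by
    have : x = X ∘ S.toList.get := rfl
    rw [this, Set.range_comp, Set.range_list_get]
    congr 1
    ext a
    simp
  have hne : Ideal.span (X '' (↑S : Set (Fin n))) ≠ (⊥ : Ideal (MvPolynomial (Fin n) k)) := by
    obtain ⟨i, hi⟩ := hS
    exact fun h => MvPolynomial.X_ne_zero i ((Ideal.span_eq_bot.mp h) _ ⟨i, hi, rfl⟩)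
  refine ⟨?_, affineBlowup.isIntegral hne, inferInstance, affineBlowup.isBirational hne⟩
  have hx : RingTheory.Sequence.IsWeaklyRegular (MvPolynomial (Fin n) k) (List.ofFn x) := by
    have h := Literature.AlgebraicGeometry.Resolution.MvPolynomial.isWeaklyRegular_map_X (R := k)
      S.toList S.nodup_toList
    have hl : List.ofFn x = S.toList.map X := by
      change List.ofFn (X ∘ S.toList.get) = _
      rw [← List.map_ofFn, List.ofFn_get]
    rwa [hl]
  haveI : IsRegularRing (MvPolynomial (Fin n) k ⧸ Ideal.span (Set.range x)) := by
    rw [hrange]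
    exact isRegularRing_quotient_span_X_image k n _
  have hreg := affineBlowup.isRegular_of_isWeaklyRegular x hx
  rwa [hrange] at hreg

end Summit.ResolutionOfSingularities.ResolutionOfSingularities.Theorems.WildQuotientResolution.LinearSmallBlocks

end
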